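import Mathlib
import Literature.Barriers.Langlands.ShimuraVarietyRealizationBarrier
import Summits.Langlands.Langlands.Theses.QuadraticWindow

/-!
# Sketch — crux-ideate `stmt-Langlands-3202` (BeyondTheWindow), round 1, ideator 2

Two checkable things only (this seat files no line and no card — see NOTES-r1-k2.md):

1. the truth table of the frame item `BeyondTheWindow := QuadraticWindowA → Langlands`
   (re-derived; the landed certificates are p83390 / p85108);
2. the group-theoretic CORE of the "window-reach monotonicity" barrier note:
   for subgroups `H' ≤ H` and any subgroup `C` of a group, `[C : C ∩ H] ∣ [C : C ∩ H']`.
   Read with `G = Gal(M/ℚ)`, `C = ⟨all complex conjugations⟩ ⊴ G`, `H = Gal(M/F) ≥ H' = Gal(M/F')`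
   for `F ⊆ F' ⊆ M`, and `[C : C ∩ Gal(M/L)] = [L : L⁺]` (`L⁺` = maximal totally real subfield,
   `= M^{Gal(M/L)·C}`), it says `d(F) ∣ d(F')` for the AI-defect `d = aiDefect` of the catalogued
   barrier `ShimuraVarietyRealizationBarrierNarrow`: the NLDS-accessible class `d ≤ 2` is closed
   under SUBFIELDS, so no finite extension of a `d ≥ 3` field is ever accessible (typed below,
   number-field dictionary left `sorry`).
-/

namespace Summit.Langlands.Langlands.Cruxes.BeyondTheWindow.Ideator2

open Summit.Langlands.Langlands.Theses.QuadraticWindow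

/-- Frame truth table: the summit implies the residual outright (an `example`, deliberately not a
named theorem: it is `Langlands → BeyondTheWindow`, not a proof of the item). -/
example (h : _root_.Langlands) : BeyondTheWindow := fun _ => h

/-- Frame truth table: the residual is `¬X ∨ Langlands`. -/
theorem beyond_iff_not_or : BeyondTheWindow ↔ (¬ QuadraticWindowA ∨ _root_.Langlands) := by
  unfold BeyondTheWindow; tauto

/-- Frame truth table: given the window theorem `X`, the residual IS the summit. -/
theorem beyond_iff_langlands_of_window (hX : QuadraticWindowA) :
    BeyondTheWindow ↔ _root_.Langlands :=
  ⟨fun h => h hX, fun h _ => h⟩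

/-- CORE of the reach-monotonicity note: `[C : C ∩ H] ∣ [C : C ∩ H']` whenever `H' ≤ H`
(Mathlib: `Subgroup.relIndex_dvd_of_le_left`; `H.relIndex C = [C : H ⊓ C]`). -/
theorem relIndex_conj_dvd {G : Type*} [Group G] (C H H' : Subgroup G) (h : H' ≤ H) :
    H.relIndex C ∣ H'.relIndex C :=
  Subgroup.relIndex_dvd_of_le_left C h

/-- TYPED number-field statement of the note (dictionary not formalised here): the AI-defect
`d(K) = [K : K⁺]` of `Literature.Barriers.Langlands.aiDefect` divides along towers `K → K'`. -/
theorem aiDefect_dvd_of_tower (K K' : Type) [Field K] [NumberField K] [Field K'] [NumberField K']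
    [Algebra K K'] :
    Literature.Barriers.Langlands.aiDefect K ∣ Literature.Barriers.Langlands.aiDefect K' := by
  sorry

/-- Corollary shape used in the note: accessibility (`d ≤ 2`) passes to subfields. -/
theorem aiDefect_le_two_of_tower (K K' : Type) [Field K] [NumberField K] [Field K']
    [NumberField K'] [Algebra K K'] (h0 : 0 < Literature.Barriers.Langlands.aiDefect K')
    (h : Literature.Barriers.Langlands.aiDefect K' ≤ 2) :
    Literature.Barriers.Langlands.aiDefect K ≤ 2 :=
  le_trans (Nat.le_of_dvd h0 (aiDefect_dvd_of_tower K K')) h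

end Summit.Langlands.Langlands.Cruxes.BeyondTheWindow.Ideator2
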